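import Summits.Parity.GeneralizedHardyLittlewood.Theses.PrimeLevelFamEdge
import Literature.NumberTheory.LFunctions.KMVSignedSecondGap
import Literature.NumberTheory.LFunctions.KMVTwistedMomentAsymptotics

/-!
# Route `PrimeLevelFamEdge` — TYPED IDEA DELTAS against the door U-d (cell ls-idea, deck 1)

PROOF-FREE `def … : Prop` deltas (idea cards that passed the cell's critics A/B/C), each stated
against the door decls `PrimeLevelFamEdge.MomentsBeyondDiagonal` (K_A, stmt-Parity-20007) /
`PrimeLevelFamEdge.BeyondDiagonalBeatsQuarter` (K_B, stmt-Parity-20343) in the tree's KMV2000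
vocabulary, plus KERNEL glue where it is a one-liner into an existing consumer («socket»);
otherwise the docstring says «glue: CLAIMED, gap = …». Docstring payload per delta = card id ·
lens · mechanism · GAP-TABLE G-id / U-d clause · why-novel · cheapest falsifier · critic verdicts
(cell files `run/shared/lean/pub/ls-idea/CARDS.md`, `cards/<seat>.md`). Imports: the route file +
Literature only (theses-cone discipline). NOTHING HERE IS ASSERTED: every `def … : Prop` is a
hypothesis SHAPE; «typed ≠ proved; no exceptional-zero theorem (no Landau–Siegel exclusion, no
Theorem 1–2 of arXiv:2211.02515, no repaired Margin232) is proved by ideation».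
-/

noncomputable section

namespace Summit.Parity.GeneralizedHardyLittlewood.Theorems.PrimeLevelFamEdgeIdeaDeltas

open Polynomial Filter Topology
open Literature.NumberTheory.LFunctions
open Literature.NumberTheory.LFunctions.KMV2000
open Summit.Parity.GeneralizedHardyLittlewood.Theses.PrimeLevelFamEdge

/-! ## §0 Socket S-B1 with a named slack profile (typing frame L2) -/

/-- **Socket S-B1 with an explicit slack profile.** `UpperControlXSq b U`: for every length
`Δ' ∈ (1, b)` the mollified second harmonic moment at prime level `q → ∞` (profile `X²`, `Q = 1`,
mollifier `q̂^{Δ'} ∉ ℕ`) is bounded ABOVE by the diagonal main term plus the card's slack `U Δ'`: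
`re Q^h(X²,1; q̂^{Δ'}) ≤ 2ζ(2)² q̂/(Δ'² log² q̂)·(4 + 4/Δ' + U(Δ')) + C q̂ log⁻³ q̂`. A PREDICATE (the
upper-control hypothesis of `Theorems.BeyondDiagonalBeatsQuarter.beyondDiagonalBeatsQuarter_of_upperControl_X_sq`,
D-0130 Strategy B, with `U` made a named profile); nothing asserted. An UPPER BOUND with constant
`< 2Δ'/(1+Δ')` × the diagonal prediction closes K_B; no evaluation is needed for K_B.
[cite: KowalskiMichelVanderKam2000, §6 p. 19 (second-moment display)] -/
def UpperControlXSq (b : ℝ) (U : ℝ → ℝ) : Prop :=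
  ∀ Δ' : ℝ, 1 < Δ' → Δ' < b → ∃ C : ℝ, ∃ q₁ : ℕ, ∀ (q : ℕ) [NeZero q], q.Prime → q₁ ≤ q →
    (∀ n : ℕ, (n : ℝ) ≠ qhat q ^ Δ') →
      (QhPQ q (X ^ 2) 1 (qhat q ^ Δ')).re ≤
        2 * (Real.pi ^ 2 / 6) ^ 2 * (qhat q / (Δ' ^ 2 * Real.log (qhat q) ^ 2)) *
            (secondMomentForm Δ' (X ^ 2) 1 + U Δ') +
          C * qhat q * (Real.log (qhat q))⁻¹ ^ 3

/-- **Glue (kernel, pure logic).** An upper control with slack profile below the band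
`4(Δ'−1)/Δ'` on `(1, b)`, `b ≤ 3/2`, is EXACTLY the hypothesis `hctl` of
`Theorems.BeyondDiagonalBeatsQuarter.beyondDiagonalBeatsQuarter_of_upperControl_X_sq` (which then
gives K_B given the repaired Petersson bound `KowalskiMichel2000.kowalskiMichel2000_peterssonBound`;
not re-imported here — theses-cone discipline). [cite: KowalskiMichelVanderKam2000, Thm. 6.1 (30)–(32), §6 p. 19] -/
theorem upperControl_hctl_of_upperControlXSq {b : ℝ} (hb1 : 1 < b) (hb : b ≤ 3 / 2) {U : ℝ → ℝ}
    (hU : ∀ Δ' : ℝ, 1 < Δ' → Δ' < b → U Δ' < 4 * (Δ' - 1) / Δ') (h : UpperControlXSq b U) :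
    ∃ b : ℝ, 1 < b ∧ b ≤ 3 / 2 ∧ ∀ Δ' : ℝ, 1 < Δ' → Δ' < b →
      ∃ U C : ℝ, U < 4 * (Δ' - 1) / Δ' ∧ ∃ q₁ : ℕ, ∀ (q : ℕ) [NeZero q], q.Prime → q₁ ≤ q →
        (∀ n : ℕ, (n : ℝ) ≠ qhat q ^ Δ') →
          (QhPQ q (X ^ 2) 1 (qhat q ^ Δ')).re ≤
            2 * (Real.pi ^ 2 / 6) ^ 2 * (qhat q / (Δ' ^ 2 * Real.log (qhat q) ^ 2)) *
                (secondMomentForm Δ' (X ^ 2) 1 + U) +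
              C * qhat q * (Real.log (qhat q))⁻¹ ^ 3 :=
  ⟨b, hb1, hb, fun Δ' h1 h2 ↦ by
    obtain ⟨C, q₁, hC⟩ := h Δ' h1 h2
    exact ⟨U Δ', C, hU Δ' h1 h2, q₁, fun q _ hq hq₁ hg ↦ hC q hq hq₁ hg⟩⟩

/-! ## §1 Level-DEPENDENT main terms: the pivot shape named by the route's KILL CRITERIA
(card K-I8-2 «Page-dichotomous K_A2», lens-8; also the vocabulary of K-I8-3's (A)-band) -/

/-- **KMV moment asymptotics on a window with LEVEL-DEPENDENT extra main terms** `T₁ q, T₂ q`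
(tables allowed to depend on the prime level `q`): verbatim `KMV2000.MomentAsymptotics Δlo Δhi` with
`Tᵢ Δ P Q` replaced by `Tᵢ q Δ P Q` inside the two displays. The route's KILL CRITERIA: «Refuted:
MomentsBeyondDiagonal (no level-independent main terms on any window beyond the diagonal) forces a
pivot to LEVEL-DEPENDENT main terms T(q̂, Δ, P, Q) (new route, not a restate)» — this predicate is
that pivot's K_A shape, typed in advance (card K-I8-2, F2: «NOT an instance of K_A ⇒ typ-1 socket
needed»). A PREDICATE; nothing asserted. [cite: KowalskiMichelVanderKam2000, §6 p. 19 (shape of the two displays)] -/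
def MomentAsymptoticsLevelDep (Δlo Δhi : ℝ) (T₁ T₂ : ℕ → ℝ → ℝ[X] → ℝ[X] → ℝ) : Prop :=
  ∀ P Q : ℝ[X], Admissible P → IsEvenOrOdd Q → ∀ Δ : ℝ, Δlo < Δ → Δ ≤ Δhi →
    ∃ C : ℝ, ∃ q₀ : ℕ, ∀ (q : ℕ) [NeZero q], q.Prime → q₀ ≤ q →
      (∀ n : ℕ, (n : ℝ) ≠ qhat q ^ Δ) →
        ‖LhPQ q P Q (qhat q ^ Δ) -
            ((riemannZeta 2 * ((Real.sqrt (qhat q) / (Δ * Real.log (qhat q)) : ℝ) : ℂ)) *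
              ((linForm Δ P Q + T₁ q Δ P Q : ℝ) : ℂ))‖ ≤
          C * Real.sqrt (qhat q) * (Real.log (qhat q))⁻¹ ^ 2 ∧
        ‖QhPQ q P Q (qhat q ^ Δ) -
            ((2 * riemannZeta 2 ^ 2 * ((qhat q / (Δ ^ 2 * Real.log (qhat q) ^ 2) : ℝ) : ℂ)) *
              ((secondMomentForm Δ P Q + T₂ q Δ P Q : ℝ) : ℂ))‖ ≤
          C * qhat q * (Real.log (qhat q))⁻¹ ^ 3

/-- Bookkeeping (proved): the door's level-FREE asymptotics are the constant-table instance of the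
level-dependent shape. [cite: KowalskiMichelVanderKam2000, §6 p. 19] -/
theorem momentAsymptoticsLevelDep_of_momentAsymptotics {Δlo Δhi : ℝ}
    {T₁ T₂ : ℝ → ℝ[X] → ℝ[X] → ℝ} (h : MomentAsymptotics Δlo Δhi T₁ T₂) :
    MomentAsymptoticsLevelDep Δlo Δhi (fun _ ↦ T₁) (fun _ ↦ T₂) :=
  h

/-- **K-I8-2 «PAGE-DICHOTOMOUS K_A2» (lens-8; critic A PASS, B/C per CARDS.md).** Mechanism: split the
beyond-diagonal resonance sum over characters `ψ` of conductor `r ≤ R(q,Δ')` à la Linnik instead of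
assuming GRH — (i) small `r`, `ψ` not induced from THE Page-exceptional character: Landau–Page region,
effective, lower order; (ii) `exp(c√log M) < r ≤ R`: log-free density + multiplicative large sieve;
(iii) `ψ = χ_D` (exists iff a Page-exceptional `D ≤ R(q,Δ')`): an explicit residue — EMITTING a
TWO-BRANCH level-dependent second table `T₂(q) = 𝟙[exc q]·T₂exc q + 𝟙[¬exc q]·T₂null`, consistent
with both worlds (unlike level-free K_A, which is ¬(A)-strength by PIN P-R1′). `exc : ℕ → Prop` = «a
Page-exceptional modulus exists at the scale of `q`» is a PARAMETER here (the card's branch test), as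
are the two tables. Controls: U-d KILL-CRITERIA pivot clause; E-060 K_A2; G-24 (explicit left side
per branch); G-27 (DH width) as input. Why novel (card): no held/galaxy text has a two-branch main term
for a mollified GL₂ moment beyond the diagonal. Falsifier (card F1): the Voronoi-weight decay
`w_ψ ≲ 1/(rφ(r))` in (ii) — if absent, branch ∅ stays GRH-conditional. MODEL-ONLY (F3). A PREDICATE;
nothing asserted; typed ≠ proved. [cite: KowalskiMichelVanderKam2000, §6 p. 19 and p. 28 (resonances under GRH)]
[cite: IwaniecConversations2006, §9.1 (Linnik's three principles)] -/
def MomentAsymptoticsTwoBranch (Δlo Δhi : ℝ) (exc : ℕ → Prop) (T₁ : ℝ → ℝ[X] → ℝ[X] → ℝ)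
    (T₂null : ℝ → ℝ[X] → ℝ[X] → ℝ) (T₂exc : ℕ → ℝ → ℝ[X] → ℝ[X] → ℝ) : Prop :=
  MomentAsymptoticsLevelDep Δlo Δhi (fun _ ↦ T₁)
    (fun q Δ P Q ↦ by classical exact if exc q then T₂exc q Δ P Q else T₂null Δ P Q)

/-- **Glue (kernel): in branch ∅ the two-branch statement IS the door's K_A on that window.** If no
level is exceptional beyond some `qN` (the ¬(A)-eventually reading of branch ∅ — NOT asserted), the
two-branch asymptotics on `(Δlo, Δhi]` give `KMV2000.MomentAsymptotics Δlo Δhi T₁ T₂null`, hence (for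
`Δlo = 1 < Δhi`) `MomentsBeyondDiagonal`. [cite: KowalskiMichelVanderKam2000, §6 p. 19] -/
theorem momentAsymptotics_of_twoBranch_of_eventually_null {Δlo Δhi : ℝ} {exc : ℕ → Prop}
    {T₁ T₂null : ℝ → ℝ[X] → ℝ[X] → ℝ} {T₂exc : ℕ → ℝ → ℝ[X] → ℝ[X] → ℝ}
    (h : MomentAsymptoticsTwoBranch Δlo Δhi exc T₁ T₂null T₂exc)
    (hnull : ∃ qN : ℕ, ∀ q : ℕ, qN ≤ q → ¬ exc q) :
    MomentAsymptotics Δlo Δhi T₁ T₂null := by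
  classical
  obtain ⟨qN, hqN⟩ := hnull
  intro P Q hP hQ Δ hlo hhi
  obtain ⟨C, q₀, hC⟩ := h P Q hP hQ Δ hlo hhi
  refine ⟨C, max q₀ qN, fun q _ hq hq₀ hg ↦ ?_⟩
  have h' := hC q hq (le_trans (le_max_left _ _) hq₀) hg
  have hx : ¬ exc q := hqN q (le_trans (le_max_right _ _) hq₀)
  simp only [hx, if_false] at h'
  exact h'

/-- **Glue to the door (kernel):** branch ∅ eventually + two-branch asymptotics on a window
`(1, Δ]`, `Δ > 1` ⇒ `MomentsBeyondDiagonal`. [cite: KowalskiMichelVanderKam2000, §6 p. 19] -/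
theorem momentsBeyondDiagonal_of_twoBranch_of_eventually_null {Δ : ℝ} (hΔ : 1 < Δ)
    {exc : ℕ → Prop} {T₁ T₂null : ℝ → ℝ[X] → ℝ[X] → ℝ} {T₂exc : ℕ → ℝ → ℝ[X] → ℝ[X] → ℝ}
    (h : MomentAsymptoticsTwoBranch 1 Δ exc T₁ T₂null T₂exc)
    (hnull : ∃ qN : ℕ, ∀ q : ℕ, qN ≤ q → ¬ exc q) : MomentsBeyondDiagonal :=
  ⟨Δ, hΔ, T₁, T₂null, momentAsymptotics_of_twoBranch_of_eventually_null h hnull⟩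

/-! ## §2 The EDGE LAW at Δ' = 1⁺ (card K-I2-2, lens-2) -/

/-- **K-I2-2 «EDGE LAW AT THE FIXED POINT» (lens-2; critic A PASS, B/C per CARDS.md).** Mechanism:
the Kuznetsov–Bykovskii kernel of the exact twisted-second-moment formula (Bykovskii–Frolenkov;
Balkanova–Frolenkov arXiv:1603.03134 Thm 4.4/§5, Cor 4.5) changes regime at `z = ℓ/N = 1`, the
image of the U-d edge `Δ' = 1`, with an integrable `(1−z)^{−1/2}` cusp; predictions: (a) CONTINUITY
`T₂(1⁺;P,Q) = 0`, (b) LINEARITY `T₂(Δ';P,Q) = s(P,Q)·(Δ'−1) + o(Δ'−1)` with an explicit slope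
`s = K_∞·ρ_{P,Q}(1)`, (c) the EDGE TEST `s < ½·second` ⟺ K_B on some `(1, b)` for that profile.
TYPED FORM (this def): every MA-consistent second table on a window `(1, Δ]` has, at `Q = 1` and
every admissible `P`, the one-sided derivative `s P` at `1⁺`: `T₂ Δ' P 1/(Δ' − 1) → s P` as
`Δ' → 1⁺`. Controls: C4′-edge sub-row of U-d (LSR-518 currency; consumer side
`edge_of_beyondDiagonalBeatsQuarter` p507701). Falsifier (card): bed D130-1 linearity check
`D(q,1.10)/D(q,1.05) ≈ 2` and `s^{meas} ≈ D(q,1.05)/0.05` vs ½ — one kit post-processing job.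
A PREDICATE with the slope functional `s` as parameter; nothing asserted; typed ≠ proved.
[cite: KowalskiMichelVanderKam2000, §6 p. 19 (the table T₂ lives in the second display)] -/
def EdgeLawAtOne (s : ℝ[X] → ℝ) : Prop :=
  ∀ Δ : ℝ, 1 < Δ → ∀ T₁ T₂ : ℝ → ℝ[X] → ℝ[X] → ℝ, MomentAsymptotics 1 Δ T₁ T₂ →
    ∀ P : ℝ[X], Admissible P →
      Tendsto (fun Δ' : ℝ ↦ T₂ Δ' P 1 / (Δ' - 1)) (𝓝[>] 1) (𝓝 (s P))

/-- Real-analysis bookkeeping (proved): if `f(Δ')/(Δ' − 1) → s < 4` as `Δ' → 1⁺`, then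
`f(Δ') < 4(Δ' − 1)/Δ'` on some initial segment `(1, b)` (the band `4(Δ'−1)/Δ'` has slope `4` at
`1⁺`). [folklore] -/
theorem exists_band_of_slope_lt_four {f : ℝ → ℝ} {s : ℝ}
    (hf : Tendsto (fun Δ' : ℝ ↦ f Δ' / (Δ' - 1)) (𝓝[>] 1) (𝓝 s)) (hs : s < 4) :
    ∃ b : ℝ, 1 < b ∧ ∀ Δ' : ℝ, 1 < Δ' → Δ' < b → f Δ' < 4 * (Δ' - 1) / Δ' := by
  -- pick σ with s < σ < 4; near 1⁺ both f/(Δ'−1) < σ and σ·Δ' < 4 hold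
  obtain ⟨σ, hsσ, hσ4⟩ := exists_between hs
  have hev₁ : ∀ᶠ Δ' in 𝓝[>] (1 : ℝ), f Δ' / (Δ' - 1) < σ := hf.eventually (Iio_mem_nhds hsσ)
  have hev₂ : ∀ᶠ Δ' in 𝓝[>] (1 : ℝ), σ * Δ' < 4 := by
    have hcont : Tendsto (fun Δ' : ℝ ↦ σ * Δ') (𝓝[>] (1 : ℝ)) (𝓝 (σ * 1)) :=
      (tendsto_id.mono_left nhdsWithin_le_nhds).const_mul σ
    rw [mul_one] at hcont
    exact hcont.eventually (Iio_mem_nhds hσ4)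
  obtain ⟨u, hu1, hu⟩ := mem_nhdsGT_iff_exists_Ioo_subset.1 (hev₁.and hev₂)
  have hu1' : (1 : ℝ) < u := hu1
  refine ⟨u, hu1', fun Δ' h1 h2 ↦ ?_⟩
  obtain ⟨hA, hB⟩ := hu ⟨h1, h2⟩
  have hpos : 0 < Δ' - 1 := by linarith
  have hΔ'pos : 0 < Δ' := by linarith
  have hT : f Δ' < σ * (Δ' - 1) := by
    have h' : f Δ' / (Δ' - 1) < σ := hA
    rwa [div_lt_iff₀ hpos] at h'
  calc f Δ' < σ * (Δ' - 1) := hT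
    _ < 4 * (Δ' - 1) / Δ' := by
        rw [lt_div_iff₀ hΔ'pos]
        have hB' : σ * Δ' < 4 := hB
        nlinarith [mul_lt_mul_of_pos_right hB' hpos]

/-- **Glue (kernel): the EDGE TEST at `X²`.** If the edge law holds with slope `s X² < 4`
(`= ½` in the card's relative currency `T₂/second`, `second(1⁺) = 8`: the band `T₂ < 4(Δ'−1)/Δ'`
has slope `4` at `1⁺`), then on every window `(1, Δ]` with MA-consistent `(T₁, T₂)` there is an
initial segment `(1, b)`, `b ≤ min Δ 2`, on which `T₂ Δ' X² 1 < 4(Δ'−1)/Δ'` — the T₂-BAND form of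
the K_B heart at `X²` (`Theorems.BeyondDiagonalBeatsQuarter.upperSomewhere_X_sq_iff_T₂_band`; with
Bettin + the repaired Petersson bound this is K_B, `secondCorrectionBelowSlackSomewhere_of_T₂_band_pb`).
[cite: KowalskiMichelVanderKam2000, Thm. 6.1 (30)–(32), §6 p. 19] -/
theorem T₂_band_near_one_of_edgeLaw {s : ℝ[X] → ℝ} (hE : EdgeLawAtOne s) (hs : s (X ^ 2) < 4)
    {Δ : ℝ} (hΔ : 1 < Δ) {T₁ T₂ : ℝ → ℝ[X] → ℝ[X] → ℝ} (hMA : MomentAsymptotics 1 Δ T₁ T₂) :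
    ∃ b : ℝ, 1 < b ∧ b ≤ min Δ 2 ∧ ∀ Δ' : ℝ, 1 < Δ' → Δ' < b →
      T₂ Δ' (X ^ 2) 1 < 4 * (Δ' - 1) / Δ' := by
  obtain ⟨u, hu1, hu⟩ :=
    exists_band_of_slope_lt_four (hE Δ hΔ T₁ T₂ hMA (X ^ 2) admissible_X_sq) hs
  exact ⟨min u (min Δ 2), lt_min hu1 (lt_min hΔ (by norm_num)), min_le_right _ _,
    fun Δ' h1 h2 ↦ hu Δ' h1 (lt_of_lt_of_le h2 (min_le_left _ _))⟩

/-! ## §3 TECHNOLOGY ⟂ INPUT split of K_A and the KNIFE-EDGE at 1⁺ (card K4-3, lens-4; merges with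
K-I2-2 per critics A/C) -/

/-- **K4-3 «TECHNOLOGY ⟂ INPUT SPLIT of K_A» (lens-4; critic A PASS+flag, C PASS-with-FIX, B per
CARDS.md).** Mechanism: split K_A into TECHNOLOGY and INPUT — `K_A^gen(H) := «H ⇒ MomentAsymptotics
on (1, 1+η] with the PRINCIPAL tables T^gen»`, `H` ranging over GL(1) equidistribution inputs for
μ-twisted sums of length `q̂^{1+η}` to conductors `≤ q^{ρ(η)}` (H = GRH(Dirichlet): KMV p. 28
«feasible» [I-S]; H = DH_A on a window W(D): card K4-1; H = BV-type averages: only the level-averaged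
IS 2000 theorem). The H-FREE dispersion deliverable (Voronoi–Ramanujan collapse at prime level +
fixed-long-residue dispersion for `y = x ⊛ x` + the principal sum rule giving `T₂^gen` in CLOSED
FORM) routes every non-principal character to the single slot `H`. TYPED FORM: the conditional
moment asymptotics with a GIVEN level-free pair of tables on the short window `(1, 1+η]`. Controls:
famE-02 split into famE-02-tech (H-free) / famE-02-input (H); C4′ new NEEDED row «∂₊(T₂^gen/second)(1⁺)
< ½» (`TableEdgeSlope` below). Falsifier (card): SO(even) density heuristic predicts the knife-edge
passes; bed cross-check D130-1 at 1.02/1.05. `H`, `η`, the tables are PARAMETERS; nothing asserted;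
typed ≠ proved. [cite: KowalskiMichelVanderKam2000, §6 p. 19 and p. 28 L74–L77 («feasible assuming GRH … [I-S]»)] -/
def KAGen (H : Prop) (η : ℝ) (T₁gen T₂gen : ℝ → ℝ[X] → ℝ[X] → ℝ) : Prop :=
  H → MomentAsymptotics 1 (1 + η) T₁gen T₂gen

/-- Glue (kernel, one line): `K_A^gen(H)` together with `H` and `η > 0` gives the door's K_A
`MomentsBeyondDiagonal` (with the principal tables as witnesses). [cite: KowalskiMichelVanderKam2000, §6 p. 19] -/
theorem momentsBeyondDiagonal_of_kAGen {H : Prop} {η : ℝ} (hη : 0 < η)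
    {T₁gen T₂gen : ℝ → ℝ[X] → ℝ[X] → ℝ} (hK : KAGen H η T₁gen T₂gen) (h : H) :
    MomentsBeyondDiagonal :=
  ⟨1 + η, by linarith, T₁gen, T₂gen, hK h⟩

/-- **The KNIFE-EDGE number of a GIVEN table at `X²`** (K4-3's new NEEDED row, K-I2-2's prediction
(b) for the principal table): `T₂gen(Δ', X², 1)/(Δ' − 1) → s` as `Δ' → 1⁺`; the card's relative
currency is `s/second(1) = s/8`, so «∂₊(T₂^gen/second)(1⁺) < ½» reads `s < 4`. A PREDICATE in the
table and the slope; nothing asserted. [cite: KowalskiMichelVanderKam2000, Thm. 6.1 (30)–(32)] -/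
def TableEdgeSlope (T₂gen : ℝ → ℝ[X] → ℝ[X] → ℝ) (s : ℝ) : Prop :=
  Tendsto (fun Δ' : ℝ ↦ T₂gen Δ' (X ^ 2) 1 / (Δ' - 1)) (𝓝[>] 1) (𝓝 s)

/-- Bookkeeping (proved): the moment asymptotics restrict to sub-windows.
[cite: KowalskiMichelVanderKam2000, §6 p. 19] -/
theorem momentAsymptotics_restrict {Δlo Δhi Δlo' Δhi' : ℝ} {T₁ T₂ : ℝ → ℝ[X] → ℝ[X] → ℝ}
    (h : MomentAsymptotics Δlo Δhi T₁ T₂) (hlo : Δlo ≤ Δlo') (hhi : Δhi' ≤ Δhi) :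
    MomentAsymptotics Δlo' Δhi' T₁ T₂ :=
  fun P Q hP hQ Δ h1 h2 ↦ h P Q hP hQ Δ (lt_of_le_of_lt hlo h1) (h2.trans hhi)

/-- **Glue (kernel): the knife-edge of the principal table decides the T₂-band for EVERY table.**
If `K_A^gen(H)` holds with `H`, `η > 0`, and the principal second table has edge slope `s < 4` at
`X²`, then for every window `(1, Δ]` and every MA-consistent `(T₁, T₂)` there is an initial segment
`(1, b)`, `b ≤ min Δ 2`, with `T₂ Δ' X² 1 < 4(Δ'−1)/Δ'` — because MA-consistent tables AGREE below
length `2` (`KMV2000.T₂_eq_of_momentAsymptotics_of_le_two`, good primes unbounded there), so the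
band passes from `T₂gen` to `T₂`. This is the T₂-band form of the K_B heart at `X²` (then K_B modulo
Bettin + the repaired Petersson bound, as for `T₂_band_near_one_of_edgeLaw`).
[cite: KowalskiMichelVanderKam2000, Thm. 6.1 (30)–(32), §6 p. 19] -/
theorem T₂_band_near_one_of_kAGen {H : Prop} {η : ℝ} (hη : 0 < η)
    {T₁gen T₂gen : ℝ → ℝ[X] → ℝ[X] → ℝ} (hK : KAGen H η T₁gen T₂gen) (h : H)
    {s : ℝ} (hs : TableEdgeSlope T₂gen s) (hs4 : s < 4)
    {Δ : ℝ} (hΔ : 1 < Δ) {T₁ T₂ : ℝ → ℝ[X] → ℝ[X] → ℝ} (hMA : MomentAsymptotics 1 Δ T₁ T₂) :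
    ∃ b : ℝ, 1 < b ∧ b ≤ min Δ 2 ∧ ∀ Δ' : ℝ, 1 < Δ' → Δ' < b →
      T₂ Δ' (X ^ 2) 1 < 4 * (Δ' - 1) / Δ' := by
  obtain ⟨u, hu1, hu⟩ := exists_band_of_slope_lt_four hs hs4
  -- common window (1, m], m := min (1+η) Δ
  set m : ℝ := min (1 + η) Δ with hm
  have hm1 : 1 < m := lt_min (by linarith) hΔ
  have hMAgen : MomentAsymptotics 1 m T₁gen T₂gen :=
    momentAsymptotics_restrict (hK h) le_rfl (min_le_left _ _)
  have hMAm : MomentAsymptotics 1 m T₁ T₂ :=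
    momentAsymptotics_restrict hMA le_rfl (min_le_right _ _)
  refine ⟨min u (min m 2), lt_min hu1 (lt_min hm1 (by norm_num)), ?_, fun Δ' h1 h2 ↦ ?_⟩
  · exact le_trans (min_le_right _ _) (min_le_min (min_le_right _ _) le_rfl)
  have hΔ'u : Δ' < u := lt_of_lt_of_le h2 (min_le_left _ _)
  have hΔ'm : Δ' ≤ m := (lt_of_lt_of_le h2 ((min_le_right _ _).trans (min_le_left _ _))).le
  have hΔ'2 : Δ' ≤ 2 := (lt_of_lt_of_le h2 ((min_le_right _ _).trans (min_le_right _ _))).le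
  have hΔ'0 : 0 < Δ' := by linarith
  have heq : T₂ Δ' (X ^ 2) 1 = T₂gen Δ' (X ^ 2) 1 :=
    T₂_eq_of_momentAsymptotics_of_le_two hMAm hMAgen admissible_X_sq isEvenOrOdd_one h1 hΔ'm
      hΔ'0 hΔ'2
  rw [heq]
  exact hu Δ' h1 hΔ'u

/-! ## §4 K-I2-1 «EXACT-FORMULA TRANSPLANT» — K_A with a NAMED witness table (lens-2; critics
A PASS · B PASS (K_A technology) · C PASS-with-FIX, novelty pending acq-11594) -/

/-- **K-I2-1 «EXACT-FORMULA TRANSPLANT» (lens-2).** Mechanism (card): start from the EXACT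
Kuznetsov–Bykovskii expression of the twisted harmonic second moment at level `N`
(Bykovskii–Frolenkov 2017; Balkanova–Frolenkov arXiv:1603.03134 Thm 6.10 / Thm 1.1), whose
non-diagonal part `ND(N;ℓ)` is an explicit kernel transform of the shifted double-divisor series
`𝓛_r`; instead of BOUNDING `ND` for `ℓ ∈ (q, q^{Δ'})` (the printed use, relative size `ℓ/N` — the
Δ < 1 wall seen from the exact-formula side), AVERAGE it against the mollifier autoconvolution and
evaluate `𝒩(Δ';P,Q) = Σ_ℓ y_ℓ ℓ^{−1/2} ND(q;ℓ)` to relative `o(1)`: the principal part of `𝓛_r` has a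
LEVEL-FREE leading coefficient after dividing by the diagonal scale — this DEFINES the candidate
table `T₂_BF(Δ',P,Q)` and makes K_A a COMPUTATION, K_B a NUMBER per profile; the residual
difficulty (the non-principal part of `𝓛_r`, divisor correlations with `q` in the SHIFT slot) is
NAMED (same object as titchmarsh-shift-transplant's ledger (I)–(III)), not hidden. TYPED FORM: K_A
WITH A NAMED WITNESS — «the table `T₂BF` (with some first table) carries the KMV asymptotics on a
window beyond the diagonal». The kernel-integral DEFINITION of `T₂_BF` itself is NOT typed here: the
BF kernels `I(z), Q₀, Q₁` and the `r`- and `ℓ`-weights are not displayed in held text (card; cf.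
Lines/titchmarsh-shift-transplant.md R2) — typable once the seat supplies the closed form; until then
`T₂BF` is a PARAMETER. Controls: G-24 C4′ (K_A existence + K_B value). Falsifier (card F1): the
model-𝕄 shadow of `𝒩` must carry the χ_D(−q) atom exactly in E-060's range. Nothing asserted;
typed ≠ proved. [cite: KowalskiMichelVanderKam2000, §6 p. 19 (second-moment display)] -/
def KAWitness (T₂BF : ℝ → ℝ[X] → ℝ[X] → ℝ) : Prop :=
  ∃ Δ : ℝ, 1 < Δ ∧ ∃ T₁ : ℝ → ℝ[X] → ℝ[X] → ℝ, MomentAsymptotics 1 Δ T₁ T₂BF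

/-- Glue (kernel, one line): a witnessed table gives the door's K_A. [cite: KowalskiMichelVanderKam2000, §6 p. 19] -/
theorem momentsBeyondDiagonal_of_kAWitness {T₂BF : ℝ → ℝ[X] → ℝ[X] → ℝ} (h : KAWitness T₂BF) :
    MomentsBeyondDiagonal := by
  obtain ⟨Δ, hΔ, T₁, hMA⟩ := h
  exact ⟨Δ, hΔ, T₁, T₂BF, hMA⟩

/-- Glue (kernel): with a witnessed table whose knife-edge at `X²` is `s < 4`, EVERY MA-consistent
table obeys the T₂-band on an initial segment (K-I2-1 ∧ K-I2-2 ⇒ the K_B heart at `X²` near `1⁺`,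
modulo Bettin + the repaired Petersson bound for K_B itself). [cite: KowalskiMichelVanderKam2000, Thm. 6.1 (30)–(32), §6 p. 19] -/
theorem T₂_band_near_one_of_kAWitness {T₂BF : ℝ → ℝ[X] → ℝ[X] → ℝ} (h : KAWitness T₂BF)
    {s : ℝ} (hs : TableEdgeSlope T₂BF s) (hs4 : s < 4)
    {Δ : ℝ} (hΔ : 1 < Δ) {T₁ T₂ : ℝ → ℝ[X] → ℝ[X] → ℝ} (hMA : MomentAsymptotics 1 Δ T₁ T₂) :
    ∃ b : ℝ, 1 < b ∧ b ≤ min Δ 2 ∧ ∀ Δ' : ℝ, 1 < Δ' → Δ' < b →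
      T₂ Δ' (X ^ 2) 1 < 4 * (Δ' - 1) / Δ' := by
  obtain ⟨Δ₀, hΔ₀, T₁₀, hMA₀⟩ := h
  have hK : KAGen True (Δ₀ - 1) T₁₀ T₂BF := fun _ ↦ by simpa using hMA₀
  exact T₂_band_near_one_of_kAGen (by linarith) hK trivial hs hs4 hΔ hMA

/-! ## §5 K-I8-3 «SIGN RIGIDITY of the level variable + the (A)-band» (lens-8; critics A PASS as
STRUCTURE · B PASS (= W-COH) · C PASS) — level-dependent vocabulary of §1; positivity ceiling proved -/

/-- **K-I8-3 «SIGN RIGIDITY + (A)-BAND» (lens-8).** Mechanism (card): Conversations (8.5)/(8.6)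
applied to the LEVELS (primes in the window `[D², D^A]`) instead of to summands: in the (A)-branch
the resonance sign `χ_D(−q)` is CONSTANT (`= −χ_D(−1)`) off a set of logarithmic density
`≤ η(A+O(1))`, `η = (1−β)log D → 0` — so (a) K_A's «main term must OSCILLATE with χ_D(−q)» is, in
the only world where the term exists, two-valued and constant on density `1 − ηA` of levels
(compatible `+` for `D < 0`, incompatible `−` for `D > 0`); (b) a plain dyadic prime-level average
does NOT wash the exceptional term out (the structural reason the bed's D130-3 «prime-averaging alone
= NO» persists); (c) the (A)-BAND: at incompatible levels (sign `−`) positivity `Q^h ≥ 0` gives the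
free CEILING `|T₂^{(A)}(q)| ≤ second·(1+o(1))` (PROVED below, fact-free, for any level-dependent
table), at compatible levels the forced split gives the FLOOR `T₂^{(A)}(q) ≥ ((Δ'−1)/(1+Δ'))·second`.
TYPED FORM: the band on a LEVEL-DEPENDENT table `T₂ q` (§1) with a compatibility predicate `compat`
(parameters). Controls: K_A why-it-might-fail clause; BED D130-3; G-24. Falsifier (card F2): the
equal-magnitude hypothesis at ± levels; MODEL-ONLY (F3). Nothing asserted; typed ≠ proved.
[cite: IwaniecConversations2006, §8 (8.5)–(8.6)] [cite: KowalskiMichelVanderKam2000, §6 p. 19] -/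
def ExceptionalLevelBand (a b : ℝ) (compat : ℕ → Prop) (T₂ : ℕ → ℝ → ℝ[X] → ℝ[X] → ℝ) : Prop :=
  ∀ P : ℝ[X], Admissible P → ∀ Δ' : ℝ, a < Δ' → Δ' < b → ∃ q₀ : ℕ, ∀ q : ℕ, q.Prime → q₀ ≤ q →
    (compat q → (Δ' - 1) / (1 + Δ') * secondMomentForm Δ' P 1 ≤ T₂ q Δ' P 1 ∧
      T₂ q Δ' P 1 ≤ secondMomentForm Δ' P 1) ∧
    (¬ compat q → -secondMomentForm Δ' P 1 ≤ T₂ q Δ' P 1 ∧ T₂ q Δ' P 1 ≤ 0)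

/-- **The free positivity CEILING for a level-dependent table (proved, fact-free).** Under
`MomentAsymptoticsLevelDep Δlo Δhi T₁ T₂`, at admissible `P`, `Q = 1`, `Δ' ∈ (Δlo, Δhi]`, `Δ' > 0`:
for every `ε > 0`, at all large good primes `q`, `−ε ≤ secondMomentForm Δ' P 1 + T₂ q Δ' P 1` —
because `Q^h(P,1) ≥ 0` at every level and the second display has relative error `O(1/log q̂)`. (The
level-FREE case is `KMV2000.secondMainTerm_nonneg_factFree`; here no limit over levels is available,
so the conclusion is per level up to `ε`.) [cite: KowalskiMichelVanderKam2000, (7) and §6 p. 19] -/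
theorem secondMainTerm_ge_neg_eps_levelDep {Δlo Δhi : ℝ} {T₁ T₂ : ℕ → ℝ → ℝ[X] → ℝ[X] → ℝ}
    (h : MomentAsymptoticsLevelDep Δlo Δhi T₁ T₂) {P : ℝ[X]} (hP : Admissible P)
    {Δ' : ℝ} (h1 : Δlo < Δ') (h2 : Δ' ≤ Δhi) (hΔ' : 0 < Δ') {ε : ℝ} (hε : 0 < ε) :
    ∃ q₀ : ℕ, ∀ (q : ℕ) [NeZero q], q.Prime → q₀ ≤ q → (∀ n : ℕ, (n : ℝ) ≠ qhat q ^ Δ') →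
      -ε ≤ secondMomentForm Δ' P 1 + T₂ q Δ' P 1 := by
  obtain ⟨C, q₀, hC⟩ := h P 1 hP isEvenOrOdd_one Δ' h1 h2
  set α : ℝ := Real.pi ^ 2 / 6 with hα_def
  have hα : 0 < α := by positivity
  set C' : ℝ := |C| * Δ' ^ 2 / (2 * α ^ 2) with hC'_def
  have hC' : 0 ≤ C' := by positivity
  obtain ⟨N, hN⟩ := exists_log_qhat_ge (C' / ε + 1)
  refine ⟨max q₀ (max N 40), fun q _ hq hq₀ hgood ↦ ?_⟩
  have hq₀' : q₀ ≤ q := le_trans (le_max_left _ _) hq₀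
  have hqN : N ≤ q := le_trans (le_trans (le_max_left _ _) (le_max_right _ _)) hq₀
  have hq40 : 40 ≤ q := le_trans (le_trans (le_max_right _ _) (le_max_right _ _)) hq₀
  have hlgB : C' / ε + 1 ≤ Real.log (qhat q) := hN q hqN
  have hlgpos : 0 < Real.log (qhat q) := by
    have : 0 ≤ C' / ε := by positivity
    linarith
  have hqhatpos : 0 < qhat q := lt_trans one_pos (one_lt_qhat hq40)
  set c₂ : ℝ := secondMomentForm Δ' P 1 + T₂ q Δ' P 1 with hc₂
  set m : ℝ := 2 * α ^ 2 * (qhat q / (Δ' ^ 2 * Real.log (qhat q) ^ 2)) with hm_def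
  have hm : 0 < m := by positivity
  obtain ⟨-, b2⟩ := hC q hq hq₀' hgood
  set R : ℝ := (QhPQ q P 1 (qhat q ^ Δ')).re with hR_def
  have hR : 0 ≤ R := QhPQ_one_re_nonneg P _
  have hQ : QhPQ q P 1 (qhat q ^ Δ') = ((R : ℝ) : ℂ) := QhPQ_one_eq_ofReal_re P _
  have hS : (2 * riemannZeta 2 ^ 2 * ((qhat q / (Δ' ^ 2 * Real.log (qhat q) ^ 2) : ℝ) : ℂ)) *
      ((c₂ : ℝ) : ℂ) = ((m * c₂ : ℝ) : ℂ) := by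
    rw [riemannZeta_two, hm_def, hα_def]; push_cast; ring
  rw [hQ, hS, ← Complex.ofReal_sub, Complex.norm_real, Real.norm_eq_abs] at b2
  have b3 : |R - m * c₂| ≤ |C| * qhat q * (Real.log (qhat q))⁻¹ ^ 3 := by
    refine b2.trans ?_
    have hs : 0 ≤ qhat q * (Real.log (qhat q))⁻¹ ^ 3 := by positivity
    rw [mul_assoc, mul_assoc]
    exact mul_le_mul_of_nonneg_right (le_abs_self C) hs
  have b4 : -( |C| * qhat q * (Real.log (qhat q))⁻¹ ^ 3) ≤ m * c₂ := by
    have := (abs_le.1 b3).2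
    linarith
  have e₂ : |C| * qhat q * (Real.log (qhat q))⁻¹ ^ 3 = m * (C' / Real.log (qhat q)) := by
    rw [hm_def, hC'_def]; field_simp
  rw [e₂, ← mul_neg] at b4
  have b5 : -(C' / Real.log (qhat q)) ≤ c₂ := le_of_mul_le_mul_left b4 hm
  have hCle : C' / Real.log (qhat q) ≤ ε := by
    rw [div_le_iff₀ hlgpos]
    have hε' : C' / ε * ε = C' := div_mul_cancel₀ _ hε.ne'
    nlinarith [mul_le_mul_of_nonneg_right hlgB hε.le]
  linarith
end Summit.Parity.GeneralizedHardyLittlewood.Theorems.PrimeLevelFamEdgeIdeaDeltas
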